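import Mathlib
import Summits.ValiantsHypothesis.ValiantsHypothesis.Theorems.RigidityForcesSymmetryRankRigidMinimalReprLaplaceFiveStarTwoTermSplit
import Summits.ValiantsHypothesis.ValiantsHypothesis.Theorems.RigidityForcesSymmetryRankRigidMinimalReprLaplaceFiveStarT1Slack
import Summits.ValiantsHypothesis.ValiantsHypothesis.Theorems.RigidityForcesSymmetryRankRigidMinimalReprLaplaceFiveStarRebase
import Summits.ValiantsHypothesis.ValiantsHypothesis.Theorems.RigidityForcesSymmetryRankRigidMinimalReprLaplaceFiveStarSameDivisor

/-!
# ValiantsHypothesis / RigidityForcesSymmetry — crux `LaplaceOptimalFive` (stmt-ValiantsHypothesis-24813), crux idea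
`young-shadow` (K1) on the star: **THE TWO-TERM ENGINE** — one closed two-term fibre, analysed to the end
(memo `NOTE-p4g15-24813-K1-star.md` §3–§5; memo `NOTE-p4g16-24813-LemmaK-kernel.md` r2 §4)

Input: a two-term letter tensor `U₁⊗W₁ + U₂⊗W₂` (symmetric factors) with the exchange identity `(C_H)`, and the polynomial
slack matrix `E_{AB} = C_{AB} − (1/20)∂_A∂_B F` of the fibre (`C_{AB} = U₁(A,B)K₁ + U₂(A,B)K₂`, `F = Q₁K₁ + Q₂K₂`).
Output (`two_term_engine`), one of:
* (o1) the fibre is ONE closed product `U⊗W` (then ✓ `weight_of_closed_product` gives weight `≥ 120`) — covers `U₁ ∥ U₂`,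
  `K_i = 0` and the T1 case `a₂ = 0`;
* (o2) T2: the columns of `U₁, U₂` lie in `span{e,f}` and `W₁, W₂` are annihilated by `{e,f}^⊥` (✓ `lemma_two_prime`);
* (o3) `E = 0` (degenerate T1, ✓ `G_eq_zero_of_degenerate`);
* (o4) PROPER T1: `λ` (`λ_{z₀} ≠ 0`), a symmetric `U''`, `a₂ ≠ 0` and `V` with `U₁, U₂ ∈ span{λλᵀ, U''}`,
  `40·E_{AB} = 15a₂·L·G_{AB}(λ,U'')` (✓ `t1_rebase` + ✓ `t1_slack_entry`) and `E_{AB} = C(¾a₂λ_Aλ_B)·L·Q'' + L²V_{AB}`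
  (✓ `t1_slack_mod_sq`) — the inputs of ✓ `same_linear_divisor` and ✓ `offDiag_relations_fine`.
`t1_engine` is the T1 half (case `s ≠ 0` of `sU₁ + tU₂ = λλᵀ`), applied twice.

No definitions, no `sorry`.  Honest framing: wiring brick, closes nothing; K1-on-the-star PAPER PASS, not kernel;
`LaplaceOptimalFive` OPEN · CONTESTED 72/120; `VP ≠ VNP` NOT proved.
-/

set_option linter.dupNamespace false

namespace Summit.ValiantsHypothesis.ValiantsHypothesis.Theorems.RigidityForcesSymmetryRankRigidMinimalRepr

namespace LaplaceFiveStar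

open Finset MvPolynomial

/-- The exchange identity passes to a pointwise-equal single product. [folklore] -/
theorem exchange_of_pointwise (U₁ U₂ U : Fin 5 → Fin 5 → ℂ) (W₁ W₂ W : Fin 5 → Fin 5 → Fin 5 → ℂ)
    (hC : ∀ A B C D E : Fin 5,
      (U₁ A C * W₁ B D E + U₁ A D * W₁ B C E + U₁ A E * W₁ B C D)
        + (U₂ A C * W₂ B D E + U₂ A D * W₂ B C E + U₂ A E * W₂ B C D)
      = (U₁ B C * W₁ A D E + U₁ B D * W₁ A C E + U₁ B E * W₁ A C D)
        + (U₂ B C * W₂ A D E + U₂ B D * W₂ A C E + U₂ B E * W₂ A C D))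
    (h : ∀ x y z w v : Fin 5, U₁ x y * W₁ z w v + U₂ x y * W₂ z w v = U x y * W z w v) (A B C D E : Fin 5) :
    U A C * W B D E + U A D * W B C E + U A E * W B C D = U B C * W A D E + U B D * W A C E + U B E * W A C D := by
  linear_combination hC A B C D E - h A C B D E - h A D B C E - h A E B C D + h B C A D E + h B D A C E + h B E A C D

/-- **T1 half of the engine** (case `s ≠ 0`). [folklore] -/
theorem t1_engine (U₁ U₂ : Fin 5 → Fin 5 → ℂ) (W₁ W₂ : Fin 5 → Fin 5 → Fin 5 → ℂ)
    (hU1 : ∀ a b : Fin 5, U₁ a b = U₁ b a) (hU2 : ∀ a b : Fin 5, U₂ a b = U₂ b a)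
    (hW1a : ∀ a b c : Fin 5, W₁ a b c = W₁ b a c) (hW1b : ∀ a b c : Fin 5, W₁ a b c = W₁ a c b)
    (hW2a : ∀ a b c : Fin 5, W₂ a b c = W₂ b a c) (hW2b : ∀ a b c : Fin 5, W₂ a b c = W₂ a c b)
    (hC : ∀ A B C D E : Fin 5,
      (U₁ A C * W₁ B D E + U₁ A D * W₁ B C E + U₁ A E * W₁ B C D)
        + (U₂ A C * W₂ B D E + U₂ A D * W₂ B C E + U₂ A E * W₂ B C D)
      = (U₁ B C * W₁ A D E + U₁ B D * W₁ A C E + U₁ B E * W₁ A C D)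
        + (U₂ B C * W₂ A D E + U₂ B D * W₂ A C E + U₂ B E * W₂ A C D))
    (hind : ∀ s t : ℂ, (∀ x w : Fin 5, s * U₁ x w + t * U₂ x w = 0) → s = 0 ∧ t = 0)
    (lam : Fin 5 → ℂ) (s t : ℂ) (hs : s ≠ 0) (hlam : ∀ x w : Fin 5, s * U₁ x w + t * U₂ x w = lam x * lam w)
    (c₁₁ c₁₂ c₂₁ c₂₂ : ℂ)
    (hK₁ : (∑ x : Fin 5, ∑ w : Fin 5, ∑ u : Fin 5, C (W₁ x w u) * X x * X w * X u : MvPolynomial (Fin 5) ℂ)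
      = (∑ z : Fin 5, lam z • (X z : MvPolynomial (Fin 5) ℂ)) *
        (C c₁₁ * (∑ x : Fin 5, ∑ w : Fin 5, C (U₁ x w) * X x * X w)
          + C c₁₂ * (∑ x : Fin 5, ∑ w : Fin 5, C (U₂ x w) * X x * X w)))
    (hK₂ : (∑ x : Fin 5, ∑ w : Fin 5, ∑ u : Fin 5, C (W₂ x w u) * X x * X w * X u : MvPolynomial (Fin 5) ℂ)
      = (∑ z : Fin 5, lam z • (X z : MvPolynomial (Fin 5) ℂ)) *
        (C c₂₁ * (∑ x : Fin 5, ∑ w : Fin 5, C (U₁ x w) * X x * X w)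
          + C c₂₂ * (∑ x : Fin 5, ∑ w : Fin 5, C (U₂ x w) * X x * X w)))
    (E : Fin 5 → Fin 5 → MvPolynomial (Fin 5) ℂ)
    (hE : ∀ A B : Fin 5, E A B
      = C (U₁ A B) * (∑ x : Fin 5, ∑ w : Fin 5, ∑ u : Fin 5, C (W₁ x w u) * X x * X w * X u)
        + C (U₂ A B) * (∑ x : Fin 5, ∑ w : Fin 5, ∑ u : Fin 5, C (W₂ x w u) * X x * X w * X u)
        - C (1 / 20 : ℂ) * pderiv A (pderiv B
          ((∑ x : Fin 5, ∑ w : Fin 5, C (U₁ x w) * X x * X w) * (∑ x : Fin 5, ∑ w : Fin 5, ∑ u : Fin 5, C (W₁ x w u) * X x * X w * X u)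
          + (∑ x : Fin 5, ∑ w : Fin 5, C (U₂ x w) * X x * X w) * (∑ x : Fin 5, ∑ w : Fin 5, ∑ u : Fin 5, C (W₂ x w u) * X x * X w * X u)))) :
    (∃ (U : Fin 5 → Fin 5 → ℂ) (W : Fin 5 → Fin 5 → Fin 5 → ℂ), (∀ x y : Fin 5, U x y = U y x) ∧
      (∀ x y z : Fin 5, W x y z = W y x z) ∧ (∀ x y z : Fin 5, W x y z = W x z y) ∧
      (∀ x y z w v : Fin 5, U₁ x y * W₁ z w v + U₂ x y * W₂ z w v = U x y * W z w v) ∧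
      (∀ A B C D E : Fin 5, U A C * W B D E + U A D * W B C E + U A E * W B C D
        = U B C * W A D E + U B D * W A C E + U B E * W A C D)) ∨
    (∀ A B : Fin 5, E A B = 0) ∨
    (∃ (mu : Fin 5 → ℂ) (z₀ : Fin 5) (U'' : Fin 5 → Fin 5 → ℂ) (a₂ : ℂ) (V : Fin 5 → Fin 5 → MvPolynomial (Fin 5) ℂ),
      mu z₀ ≠ 0 ∧ a₂ ≠ 0 ∧ (∀ x y : Fin 5, U'' x y = U'' y x) ∧
      (∃ α β γ δ : ℂ, ∀ x y : Fin 5,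
        U₁ x y = α * (mu x * mu y) + β * U'' x y ∧ U₂ x y = γ * (mu x * mu y) + δ * U'' x y) ∧
      (∀ A B : Fin 5, 40 * E A B = 15 * C a₂ * (∑ z : Fin 5, mu z • (X z : MvPolynomial (Fin 5) ℂ)) *
        (2 * (∑ z : Fin 5, mu z • (X z : MvPolynomial (Fin 5) ℂ)) ^ 2 * C (U'' A B)
          - (∑ z : Fin 5, mu z • (X z : MvPolynomial (Fin 5) ℂ)) *
            (C (mu A) * pderiv B (∑ x : Fin 5, ∑ w : Fin 5, C (U'' x w) * X x * X w)
              + C (mu B) * pderiv A (∑ x : Fin 5, ∑ w : Fin 5, C (U'' x w) * X x * X w))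
          + 2 * C (mu A * mu B) * (∑ x : Fin 5, ∑ w : Fin 5, C (U'' x w) * X x * X w))) ∧
      (∀ A B : Fin 5, E A B = C (3 * a₂ / 4 * (mu A * mu B)) * (∑ z : Fin 5, mu z • (X z : MvPolynomial (Fin 5) ℂ))
          * (∑ x : Fin 5, ∑ w : Fin 5, C (U'' x w) * X x * X w)
        + (∑ z : Fin 5, mu z • (X z : MvPolynomial (Fin 5) ℂ)) ^ 2 * V A B)) := by
  set L : MvPolynomial (Fin 5) ℂ := ∑ z : Fin 5, lam z • (X z : MvPolynomial (Fin 5) ℂ) with hL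
  set Q₁ : MvPolynomial (Fin 5) ℂ := ∑ x : Fin 5, ∑ w : Fin 5, C (U₁ x w) * X x * X w with hQ₁
  set Q₂ : MvPolynomial (Fin 5) ℂ := ∑ x : Fin 5, ∑ w : Fin 5, C (U₂ x w) * X x * X w with hQ₂
  set K₁ : MvPolynomial (Fin 5) ℂ := ∑ x : Fin 5, ∑ w : Fin 5, ∑ u : Fin 5, C (W₁ x w u) * X x * X w * X u with hK₁d
  set K₂ : MvPolynomial (Fin 5) ℂ := ∑ x : Fin 5, ∑ w : Fin 5, ∑ u : Fin 5, C (W₂ x w u) * X x * X w * X u with hK₂d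
  obtain ⟨z₀, a₁, b₁, a₂, W₁', W₂', hz₀, hrel, hW1'a, hW1'b, hW2'a, hW2'b, hpt, hU1e, hk₁, hk₂, hCab, hquint⟩ :=
    t1_rebase U₁ U₂ W₁ W₂ hU1 hU2 hW1a hW1b hW2a hW2b hC hind lam s t hs hlam c₁₁ c₁₂ c₂₁ c₂₂ hK₁ hK₂
  by_cases ha₂ : a₂ = 0
  · -- `k₂ = 0`: the fibre is the closed product `λλᵀ ⊗ W₁'`
    left
    have hW2'0 : ∀ x y z : Fin 5, W₂' x y z = 0 :=
      cubic_tensor_eq_zero W₂' hW2'a hW2'b (by rw [hk₂, ha₂, C_0, zero_mul])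
    have hpt' : ∀ x y z w v : Fin 5, U₁ x y * W₁ z w v + U₂ x y * W₂ z w v = (lam x * lam y) * W₁' z w v :=
      fun x y z w v => by rw [hpt, hW2'0, mul_zero, add_zero]
    exact ⟨fun x y => lam x * lam y, W₁', fun x y => by ring, hW1'a, hW1'b, hpt',
      exchange_of_pointwise U₁ U₂ _ W₁ W₂ W₁' hC hpt'⟩
  right
  -- the slack of a T1 fibre
  set k₁ : MvPolynomial (Fin 5) ℂ := L * (C a₁ * L ^ 2 + C b₁ * Q₂) with hk₁d
  have hQ2d : ∀ A B : Fin 5, pderiv A (pderiv B Q₂) = 2 * C (U₂ A B) := by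
    intro A B
    rw [hQ₂, pderiv_pderiv_quadric U₂ hU2 B A, hU2 B A, map_mul, show (C (2 : ℂ) : MvPolynomial (Fin 5) ℂ) = 2 from
      map_ofNat C 2]
  have hE40 : ∀ A B : Fin 5, 40 * E A B = 15 * C a₂ * L * (2 * L ^ 2 * C (U₂ A B)
      - L * (C (lam A) * pderiv B Q₂ + C (lam B) * pderiv A Q₂) + 2 * C (lam A * lam B) * Q₂) := by
    intro A B
    have h := t1_slack_entry lam Q₂ a₁ b₁ a₂ hrel A B (U₂ A B) (hQ2d A B)
    simp only at h
    rw [← h, hE A B]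
    show 40 * (C (U₁ A B) * K₁ + C (U₂ A B) * K₂ - C (1 / 20 : ℂ) * pderiv A (pderiv B (Q₁ * K₁ + Q₂ * K₂))) = _
    rw [hCab A B, hquint]
    have h20 : (40 : MvPolynomial (Fin 5) ℂ) * C (1 / 20 : ℂ) = 2 := by
      rw [show (40 : MvPolynomial (Fin 5) ℂ) = C (40 : ℂ) from (map_ofNat C 40).symm, ← map_mul,
        show (40 : ℂ) * (1 / 20) = 2 by norm_num, map_ofNat]
    linear_combination (-(pderiv A (pderiv B (L ^ 2 * (L * (C a₁ * L ^ 2 + C b₁ * Q₂)) + Q₂ * (C a₂ * L ^ 3))))) * h20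
  by_cases hdeg : ∃ m : Fin 5 → ℂ, ∀ a b : Fin 5, U₂ a b = lam a * m b + m a * lam b
  · -- degenerate: `G ≡ 0`, so `E = 0`
    left
    obtain ⟨m, hm⟩ := hdeg
    intro A B
    have hG := G_eq_zero_of_degenerate lam m U₂ hm A B
    simp only [← hL, ← hQ₂] at hG
    have h := hE40 A B
    rw [hG, mul_zero] at h
    have h40 : (40 : MvPolynomial (Fin 5) ℂ) ≠ 0 := by
      rw [show (40 : MvPolynomial (Fin 5) ℂ) = C (40 : ℂ) from (map_ofNat C 40).symm, Ne, C_eq_zero]; norm_num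
    exact (mul_eq_zero.mp h).resolve_left h40
  · right
    -- proper T1
    refine ⟨lam, z₀, U₂, a₂, fun A B => C (1 / 40 : ℂ) * Classical.choose (t1_slack_mod_sq lam Q₂ a₂ A B (U₂ A B)),
      hz₀, ha₂, hU2, ⟨s⁻¹, -(s⁻¹ * t), 0, 1, fun x y => ⟨by rw [hU1e]; ring, by ring⟩⟩, hE40, fun A B => ?_⟩
    show E A B = C (3 * a₂ / 4 * (lam A * lam B)) * L * Q₂
      + L ^ 2 * (C (1 / 40 : ℂ) * Classical.choose (t1_slack_mod_sq lam Q₂ a₂ A B (U₂ A B)))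
    have hV := Classical.choose_spec (t1_slack_mod_sq lam Q₂ a₂ A B (U₂ A B))
    simp only [← hL] at hV
    -- `40 E = 15 a₂ L G = 30 a₂ λ_Aλ_B L Q₂ + L² V`
    have h := hE40 A B
    have h40 : C (1 / 40 : ℂ) * (40 : MvPolynomial (Fin 5) ℂ) = 1 := by
      rw [show (40 : MvPolynomial (Fin 5) ℂ) = C (40 : ℂ) from (map_ofNat C 40).symm, ← map_mul,
        show (1 / 40 : ℂ) * 40 = 1 by norm_num, map_one]
    have hc : (C (3 * a₂ / 4 * (lam A * lam B)) : MvPolynomial (Fin 5) ℂ) = C (1 / 40 : ℂ) * 30 * C (a₂ * (lam A * lam B)) := by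
      rw [show (30 : MvPolynomial (Fin 5) ℂ) = C (30 : ℂ) from (map_ofNat C 30).symm, ← map_mul, ← map_mul]
      congr 1
      ring
    rw [hc]
    linear_combination (-(E A B)) * h40 + (C (1 / 40 : ℂ)) * h + C (1 / 40 : ℂ) * hV

/-- **The two-term engine.** [folklore] -/
theorem two_term_engine (U₁ U₂ : Fin 5 → Fin 5 → ℂ) (W₁ W₂ : Fin 5 → Fin 5 → Fin 5 → ℂ)
    (hU1 : ∀ a b : Fin 5, U₁ a b = U₁ b a) (hU2 : ∀ a b : Fin 5, U₂ a b = U₂ b a)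
    (hW1a : ∀ a b c : Fin 5, W₁ a b c = W₁ b a c) (hW1b : ∀ a b c : Fin 5, W₁ a b c = W₁ a c b)
    (hW2a : ∀ a b c : Fin 5, W₂ a b c = W₂ b a c) (hW2b : ∀ a b c : Fin 5, W₂ a b c = W₂ a c b)
    (hC : ∀ A B C D E : Fin 5,
      (U₁ A C * W₁ B D E + U₁ A D * W₁ B C E + U₁ A E * W₁ B C D)
        + (U₂ A C * W₂ B D E + U₂ A D * W₂ B C E + U₂ A E * W₂ B C D)
      = (U₁ B C * W₁ A D E + U₁ B D * W₁ A C E + U₁ B E * W₁ A C D)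
        + (U₂ B C * W₂ A D E + U₂ B D * W₂ A C E + U₂ B E * W₂ A C D))
    (E : Fin 5 → Fin 5 → MvPolynomial (Fin 5) ℂ)
    (hE : ∀ A B : Fin 5, E A B
      = C (U₁ A B) * (∑ x : Fin 5, ∑ w : Fin 5, ∑ u : Fin 5, C (W₁ x w u) * X x * X w * X u)
        + C (U₂ A B) * (∑ x : Fin 5, ∑ w : Fin 5, ∑ u : Fin 5, C (W₂ x w u) * X x * X w * X u)
        - C (1 / 20 : ℂ) * pderiv A (pderiv B
          ((∑ x : Fin 5, ∑ w : Fin 5, C (U₁ x w) * X x * X w) * (∑ x : Fin 5, ∑ w : Fin 5, ∑ u : Fin 5, C (W₁ x w u) * X x * X w * X u)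
          + (∑ x : Fin 5, ∑ w : Fin 5, C (U₂ x w) * X x * X w) * (∑ x : Fin 5, ∑ w : Fin 5, ∑ u : Fin 5, C (W₂ x w u) * X x * X w * X u)))) :
    (∃ (U : Fin 5 → Fin 5 → ℂ) (W : Fin 5 → Fin 5 → Fin 5 → ℂ), (∀ x y : Fin 5, U x y = U y x) ∧
      (∀ x y z : Fin 5, W x y z = W y x z) ∧ (∀ x y z : Fin 5, W x y z = W x z y) ∧
      (∀ x y z w v : Fin 5, U₁ x y * W₁ z w v + U₂ x y * W₂ z w v = U x y * W z w v) ∧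
      (∀ A B C D E : Fin 5, U A C * W B D E + U A D * W B C E + U A E * W B C D
        = U B C * W A D E + U B D * W A C E + U B E * W A C D)) ∨
    (∃ e f : Fin 5 → ℂ,
      (∀ d : Fin 5, (∃ s t : ℂ, ∀ x : Fin 5, U₁ x d = s * e x + t * f x) ∧ (∃ s t : ℂ, ∀ x : Fin 5, U₂ x d = s * e x + t * f x)) ∧
      (∀ v : Fin 5 → ℂ, ∑ x : Fin 5, v x * e x = 0 → ∑ x : Fin 5, v x * f x = 0 → ∀ b c : Fin 5, ∑ a : Fin 5, v a * W₁ a b c = 0) ∧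
      (∀ v : Fin 5 → ℂ, ∑ x : Fin 5, v x * e x = 0 → ∑ x : Fin 5, v x * f x = 0 → ∀ b c : Fin 5, ∑ a : Fin 5, v a * W₂ a b c = 0)) ∨
    (∀ A B : Fin 5, E A B = 0) ∨
    (∃ (mu : Fin 5 → ℂ) (z₀ : Fin 5) (U'' : Fin 5 → Fin 5 → ℂ) (a₂ : ℂ) (V : Fin 5 → Fin 5 → MvPolynomial (Fin 5) ℂ),
      mu z₀ ≠ 0 ∧ a₂ ≠ 0 ∧ (∀ x y : Fin 5, U'' x y = U'' y x) ∧
      (∃ α β γ δ : ℂ, ∀ x y : Fin 5,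
        U₁ x y = α * (mu x * mu y) + β * U'' x y ∧ U₂ x y = γ * (mu x * mu y) + δ * U'' x y) ∧
      (∀ A B : Fin 5, 40 * E A B = 15 * C a₂ * (∑ z : Fin 5, mu z • (X z : MvPolynomial (Fin 5) ℂ)) *
        (2 * (∑ z : Fin 5, mu z • (X z : MvPolynomial (Fin 5) ℂ)) ^ 2 * C (U'' A B)
          - (∑ z : Fin 5, mu z • (X z : MvPolynomial (Fin 5) ℂ)) *
            (C (mu A) * pderiv B (∑ x : Fin 5, ∑ w : Fin 5, C (U'' x w) * X x * X w)
              + C (mu B) * pderiv A (∑ x : Fin 5, ∑ w : Fin 5, C (U'' x w) * X x * X w))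
          + 2 * C (mu A * mu B) * (∑ x : Fin 5, ∑ w : Fin 5, C (U'' x w) * X x * X w))) ∧
      (∀ A B : Fin 5, E A B = C (3 * a₂ / 4 * (mu A * mu B)) * (∑ z : Fin 5, mu z • (X z : MvPolynomial (Fin 5) ℂ))
          * (∑ x : Fin 5, ∑ w : Fin 5, C (U'' x w) * X x * X w)
        + (∑ z : Fin 5, mu z • (X z : MvPolynomial (Fin 5) ℂ)) ^ 2 * V A B)) := by
  set Q₁ : MvPolynomial (Fin 5) ℂ := ∑ x : Fin 5, ∑ w : Fin 5, C (U₁ x w) * X x * X w with hQ₁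
  set Q₂ : MvPolynomial (Fin 5) ℂ := ∑ x : Fin 5, ∑ w : Fin 5, C (U₂ x w) * X x * X w with hQ₂
  set K₁ : MvPolynomial (Fin 5) ℂ := ∑ x : Fin 5, ∑ w : Fin 5, ∑ u : Fin 5, C (W₁ x w u) * X x * X w * X u with hK₁d
  set K₂ : MvPolynomial (Fin 5) ℂ := ∑ x : Fin 5, ∑ w : Fin 5, ∑ u : Fin 5, C (W₂ x w u) * X x * X w * X u with hK₂d
  by_cases hind : ∀ s t : ℂ, (∀ x w : Fin 5, s * U₁ x w + t * U₂ x w = 0) → s = 0 ∧ t = 0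
  swap
  · -- `U₁ ∥ U₂`: one closed product
    left
    simp only [not_forall, not_and, exists_prop] at hind
    obtain ⟨s, t, hst, hst0⟩ := hind
    by_cases ht : t = 0
    · have hs : s ≠ 0 := fun h => hst0 h ht
      have hU10 : ∀ x w : Fin 5, U₁ x w = 0 := fun x w => by
        have h := hst x w
        rw [ht, zero_mul, add_zero] at h
        exact (mul_eq_zero.mp h).resolve_left hs
      have hpt : ∀ x y z w v : Fin 5, U₁ x y * W₁ z w v + U₂ x y * W₂ z w v = U₂ x y * W₂ z w v :=
        fun x y z w v => by rw [hU10, zero_mul, zero_add]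
      exact ⟨U₂, W₂, hU2, hW2a, hW2b, hpt, exchange_of_pointwise U₁ U₂ U₂ W₁ W₂ W₂ hC hpt⟩
    · have hpt : ∀ x y z w v : Fin 5, U₁ x y * W₁ z w v + U₂ x y * W₂ z w v
          = U₁ x y * (W₁ z w v - s / t * W₂ z w v) := by
        intro x y z w v
        have h := hst x y
        have hU2e : U₂ x y = -(s / t) * U₁ x y := by field_simp; linear_combination h
        rw [hU2e]
        ring
      exact ⟨U₁, fun z w v => W₁ z w v - s / t * W₂ z w v, hU1, fun x y z => by dsimp only; rw [hW1a, hW2a],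
        fun x y z => by dsimp only; rw [hW1b, hW2b], hpt, exchange_of_pointwise U₁ U₂ U₁ W₁ W₂ _ hC hpt⟩
  rcases lemma_two_prime U₁ U₂ W₁ W₂ hU1 hU2 hW1a hW1b hW2a hW2b hind hC Q₁ Q₂ K₁ K₂ rfl rfl rfl rfl with
    hT2 | ⟨lam, s, t, hst, hlam, ⟨c₁₁, c₁₂, hK₁⟩, ⟨c₂₁, c₂₂, hK₂⟩⟩ | hK10 | hK20
  · exact Or.inr (Or.inl hT2)
  · -- T1: rebase on the side with a non-zero coefficient
    rcases hst with hs | ht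
    · rcases t1_engine U₁ U₂ W₁ W₂ hU1 hU2 hW1a hW1b hW2a hW2b hC hind lam s t hs hlam c₁₁ c₁₂ c₂₁ c₂₂ hK₁ hK₂ E hE
        with h1 | h3 | h4
      · exact Or.inl h1
      · exact Or.inr (Or.inr (Or.inl h3))
      · exact Or.inr (Or.inr (Or.inr h4))
    · -- swap the roles of the two terms
      have hC' : ∀ A B C D E : Fin 5,
          (U₂ A C * W₂ B D E + U₂ A D * W₂ B C E + U₂ A E * W₂ B C D)
            + (U₁ A C * W₁ B D E + U₁ A D * W₁ B C E + U₁ A E * W₁ B C D)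
          = (U₂ B C * W₂ A D E + U₂ B D * W₂ A C E + U₂ B E * W₂ A C D)
            + (U₁ B C * W₁ A D E + U₁ B D * W₁ A C E + U₁ B E * W₁ A C D) := fun A B C D E => by
        linear_combination hC A B C D E
      have hind' : ∀ s t : ℂ, (∀ x w : Fin 5, s * U₂ x w + t * U₁ x w = 0) → s = 0 ∧ t = 0 :=
        fun s' t' h => (hind t' s' fun x w => by linear_combination h x w).symm
      have hlam' : ∀ x w : Fin 5, t * U₂ x w + s * U₁ x w = lam x * lam w := fun x w => by
        linear_combination hlam x w
      have hK₂' : K₂ = (∑ z : Fin 5, lam z • (X z : MvPolynomial (Fin 5) ℂ)) * (C c₂₂ * Q₂ + C c₂₁ * Q₁) := by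
        rw [hK₂]; ring
      have hK₁' : K₁ = (∑ z : Fin 5, lam z • (X z : MvPolynomial (Fin 5) ℂ)) * (C c₁₂ * Q₂ + C c₁₁ * Q₁) := by
        rw [hK₁]; ring
      have hE' : ∀ A B : Fin 5, E A B = C (U₂ A B) * K₂ + C (U₁ A B) * K₁
          - C (1 / 20 : ℂ) * pderiv A (pderiv B (Q₂ * K₂ + Q₁ * K₁)) := fun A B => by
        rw [hE A B]
        show C (U₁ A B) * K₁ + C (U₂ A B) * K₂ - C (1 / 20 : ℂ) * pderiv A (pderiv B (Q₁ * K₁ + Q₂ * K₂)) = _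
        rw [add_comm (C (U₁ A B) * K₁), add_comm (Q₁ * K₁)]
      rcases t1_engine U₂ U₁ W₂ W₁ hU2 hU1 hW2a hW2b hW1a hW1b hC' hind' lam t s ht hlam' c₂₂ c₂₁ c₁₂ c₁₁ hK₂' hK₁' E hE'
        with ⟨U, W, hU, hWa, hWb, hpt, hCU⟩ | h3 | ⟨mu, z₀, U'', a₂, V, hz₀, ha₂, hU'', ⟨α, β, γ, δ, hcols⟩, h40, hshape⟩
      · exact Or.inl ⟨U, W, hU, hWa, hWb, fun x y z w v => by rw [← hpt x y z w v]; ring, hCU⟩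
      · exact Or.inr (Or.inr (Or.inl h3))
      · exact Or.inr (Or.inr (Or.inr ⟨mu, z₀, U'', a₂, V, hz₀, ha₂, hU'',
          ⟨γ, δ, α, β, fun x y => ⟨(hcols x y).2, (hcols x y).1⟩⟩, h40, hshape⟩))
  · -- `K₁ = 0`: the fibre is `U₂ ⊗ W₂`
    left
    have hW10 : ∀ x y z : Fin 5, W₁ x y z = 0 := cubic_tensor_eq_zero W₁ hW1a hW1b hK10
    have hpt : ∀ x y z w v : Fin 5, U₁ x y * W₁ z w v + U₂ x y * W₂ z w v = U₂ x y * W₂ z w v :=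
      fun x y z w v => by rw [hW10, mul_zero, zero_add]
    exact ⟨U₂, W₂, hU2, hW2a, hW2b, hpt, exchange_of_pointwise U₁ U₂ U₂ W₁ W₂ W₂ hC hpt⟩
  · left
    have hW20 : ∀ x y z : Fin 5, W₂ x y z = 0 := cubic_tensor_eq_zero W₂ hW2a hW2b hK20
    have hpt : ∀ x y z w v : Fin 5, U₁ x y * W₁ z w v + U₂ x y * W₂ z w v = U₁ x y * W₁ z w v :=
      fun x y z w v => by rw [hW20, mul_zero, add_zero]
    exact ⟨U₁, W₁, hU1, hW1a, hW1b, hpt, exchange_of_pointwise U₁ U₂ U₁ W₁ W₂ W₁ hC hpt⟩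

end LaplaceFiveStar

end Summit.ValiantsHypothesis.ValiantsHypothesis.Theorems.RigidityForcesSymmetryRankRigidMinimalRepr
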